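import Summits.QuantumAdvantage.QuantumAdvantage.Theses.SymplecticPurity
import Summits.QuantumAdvantage.QuantumAdvantage.Theses.Shor
import Literature.Computability.QuantumComplexity.BQPEqBPPIff
import Literature.Computability.QuantumComplexity.BQPContainmentsProofs
import Literature.Computability.QuantumComplexity.BQPSubsetPP
import Literature.Computability.Cryptography.ShorAssemblyLeavesProofs
import Literature.Computability.QuantumComplexity.OracleSeparationsProofs
import Literature.Barriers.QuantumAdvantage.RelativizationProofs
import Literature.Barriers.QuantumAdvantage.AlgebrizationProofs
import Literature.Computability.Complexity.UniformDerandomizationEndgame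
import Literature.Computability.Complexity.ProbabilisticClassesProofs
import Literature.Computability.MetaComplexity.RandReductionsLeak
import Literature.Computability.Cryptography.PostselectionPostBQPProofs
import Literature.Computability.Cryptography.KitaevPhaseEstimationCircuit
import Literature.Computability.Cryptography.ClassBQPProofs
import Literature.Computability.Cryptography.ClassBQPRelProofs
import Literature.Computability.Cryptography.QuantumCircuitProofs
import Literature.Computability.Cryptography.TCount
import Literature.Computability.QuantumComplexity.BQPErrorReductionProofs
import Literature.Computability.Complexity.PromiseZPPProofs

/-!
# Disproof of `deq_thesis` (`FFThesis := BQP ⊆ BPP`) — findings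

Work file of the standing disprover (refuter `cdisprove`, crux item `stmt-QuantumAdvantage-0242`,
gen 1). The crux is THESIS X of the ¬S-side routes — one shared item whose route decls
(`SymplecticPurity.FFThesis`, `Dequantize.DeqThesis`, `PauliFlat.PPThesis`,
`ShorLocallyDark.ClosureThesis`, `RectangleFree.KcThesis`, `ModularRank.Target`, …) are all the
same term `Literature.Computability.Cryptography.BQP ⊆ Literature.Computability.Complexity.BPP`.
Everything below ELABORATES, no `sorry` (there is no `NearMisses` section: see `resists`).

## Findings (index)

* §0 `ffThesis_iff`, `ffThesis_iff_bqpEqBPP` — the statement read back: X is `BQP ⊆ BPP`, i.e. the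
  tree's `@[conjecture] BQPEqBPP` (antisymmetry with the PROVED `BPP ⊆ BQP`).
  DEFINITIONS AUDITED (NOTES.md §Definitions): `BQP = BQPWith cliffordT (1/3)` over genuine
  poly-time-uniform (`PolyTimeComputable` description map), oracle-free Clifford+T families with
  concrete unitary gate matrices and Born-rule acceptance on wire `0`; `BPP = bp P` over Mathlib-TM2
  polynomial time. No junk found in either direction: `P ⊆ BPP ⊆ BQP ⊆ PP ⊆ PSPACE` and `FACT ∈ BQP`
  are all tree THEOREMS, so X sits exactly where the printed open problem sits. (Warning for
  re-phrasings: `BPP = bp P` has a LITERAL polynomial coin budget and is countable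
  (`countable_BPP`); the tree's machine classes over `RandAlg`/`IsPPT` only BOUND the budget and
  leak advice — cf. `not_countable_sampP` in `SamplingProblemsCardinality.lean` — so a thesis
  restated over such a class would be junk-refutable. None of the nine routes does this.)
* §1 `not_ffThesis_iff_quantumAdvantage` — **a kill of this crux is the summit itself**
  (`¬ X ↔ QuantumAdvantage`, same terms). There is no cheaper refutation to look for.
* §2 `ffThesis_false_of_FACT_not_mem_BPP` / `ffThesis_false_of_shorThesis` — the negative lemma
  modulo the classical hardness of factoring (`FACT ∉ BPP → ¬ X`, from the tree theorem
  `FACT_mem_BQP_holds`, Shor), typed as a NEGATIVE EDGE from the registered item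
  `Shor.ShorThesis` (stmt-0231) so the audit indexes `0231 ⇒ ¬0242` (and the mirror
  `shorThesis_false_of_ffThesis`). (`H` is a hardness CONJECTURE, not a constructible object, so
  this is filed as a plain negative lemma, not `--negative-modulo`.)
* §3 WHY IT RESISTS, as theorems: a kill gives `¬ PSPACE ⊆ BPP`, `¬ PP ⊆ BPP`, `P ≠ PSPACE`
  (`not_PSPACE_subset_BPP_of_not_ffThesis`, `not_PP_subset_BPP_of_not_ffThesis`,
  `P_ne_PSPACE_of_not_ffThesis`); the relativized thesis AND the relativized kill are both false
  (`not_forall_oracle_thesis`, `not_forall_oracle_kill`: BV recursive Fourier sampling resp. a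
  PSPACE-complete oracle, tree theorems), packaged with the catalogued barriers (Literature theorems
  `Relativization.not_relativizes_either'`, `Algebrization.not_isAlgebrizingSeparation_bit'`, both
  PROVED) in `kill_must_evade_relativization_and_algebrization`: any disproof must be
  non-relativizing and non-algebrizing.
* §4 LOAD-BEARING PARAMETERS of the definition (the crux has no hypotheses; its content is in the
  three parameters of `BQP`): (a) oracle-freeness is NOT load-bearing (`ffThesis_iff_BQPRel_zero`);
  (b) UNIFORMITY IS: `ffThesis_false_without_uniformity : ¬ (BQPNonuniform ⊆ BPP)` — polynomial-size
  NON-uniform Clifford+T families decide every length-language exactly (explicit 3-operation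
  reversible witness `lengthFamily`, `lengthFamily_acceptProbOn`), `2^ℵ₀` languages against the
  countable `BPP` (tree theorem `countable_BPP`). SHARPENED for the state-complexity roads
  (`exists_tfree_basis_family_deciding_non_BPP`): the witness is `T`-FREE (`tCount = 0`, pure
  Clifford) and maps basis states to basis states (product states: bond dimension 1, stabilizer
  rank 1), yet decides a non-`BPP` language — so NO bound on entanglement / magic / Pauli spectrum /
  stabilizer rank of the STATES of a family implies `BPP`-membership by itself: the roads H_FF,
  H_PP, H_CL, stabilizer-rank dequantization must thread the uniform generator through the
  simulation; (c) THE ERROR BOUND `ε < 1/2` IS: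
  `ffThesis_false_without_gap : ¬ (BQPWith cliffordT (1/2) ⊆ BPP)` — the UNIFORM coin family
  `hadFamily` accepts every non-empty input with probability EXACTLY `1/2`
  (`hadFamily_acceptProbOn`), and at the cut-point the two NON-STRICT clauses of `BQPWith` are both
  satisfied by such ties, so every language avoiding `[]` is "decided": the definition DEGENERATES
  for every `ε ≥ 1/2` (`not_BQPWith_subset_BPP`), while for `0 < ε < 1/2` it is `BQP` (tree theorem
  `BQPWith_eq_BQP_holds`) — a sharp dichotomy in `ε`. CAVEAT (honest reading): this kill exploits
  exact ties, not computational power; the STRICT unbounded-error variant (`x ∈ L ↔ Pr > 1/2`) is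
  `PP`-like and its inclusion in `BPP` is open — not claimed. Both (b), (c) are strengthenings of X
  (`BQP_subset_BQPNonuniform`, `ffThesis_of_withoutGap`), refuted outright.
  (d) gate set: not formalised — with non-computable amplitudes uniform families decide languages
  of arbitrary Turing degree (Adleman–DeMarrais–Huang 1997), so `cliffordT` (algebraic entries) is
  load-bearing too; recorded in NOTES.md only.
* LANDED under `Theorems/DeqThesis/Negative/` (cycle 1, all ACCEPTED): `DeqThesisFalseWithoutUniformity.lean`
  (p82784), `DeqThesisFalseWithoutGap.lean` (p82839), `DeqThesisKillIsSummit.lean` (p83170),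
  `DeqThesisShorEdge.lean` (p82708) — importable as
  `Summits.QuantumAdvantage.QuantumAdvantage.Theorems.DeqThesis.Negative.*`.
* §5 Targets: none yet (payload.targets = [] at gen 1).
* §6 `resists` — docstring summary for ideators/planners.
-/

set_option linter.dupNamespace false -- namespace `Summit.QuantumAdvantage.QuantumAdvantage…` (D-0017, single-conjunct summit)

open Computability
open Literature.Computability.Complexity Literature.Computability.Complexity.Classes
open Literature.Computability.Cryptography Literature.Computability.QuantumComplexity
open Literature.Barriers.QuantumAdvantage Literature.Barriers.PneNP

noncomputable section

namespace Summit.QuantumAdvantage.QuantumAdvantage.Cruxes.DeqThesis.Disproof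

open Summit.QuantumAdvantage.QuantumAdvantage.Theses.SymplecticPurity (FFThesis)
open Summit.QuantumAdvantage.QuantumAdvantage.Theses.Shor (ShorThesis)

/-- The crux, unfolded: `FFThesis` is literally `BQP ⊆ BPP`. [folklore] -/
theorem ffThesis_iff : FFThesis ↔ BQP ⊆ BPP := Iff.rfl

/-- The crux is the tree's open conjecture `BQPEqBPP : BQP = BPP` (antisymmetry with the PROVED
`BPP ⊆ BQP`, `BPP_subset_BQP_holds`). [cite: BernsteinVazirani1997, Thm. 8.3] -/
theorem ffThesis_iff_bqpEqBPP : FFThesis ↔ BQPEqBPP := bqpEqBPP_iff_subset.symm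

/-- **A kill of the crux IS the summit**: `¬ FFThesis ↔ QuantumAdvantage` (same terms). [folklore] -/
theorem not_ffThesis_iff_quantumAdvantage : ¬ FFThesis ↔ _root_.QuantumAdvantage := by
  show ¬ (BQP ⊆ BPP) ↔ ∃ L : Language Bool, L ∈ BQP ∧ L ∉ BPP
  rw [Set.not_subset]

/-- `FFThesis` puts the factoring language `FACT` in `BPP` (Shor: `FACT ∈ BQP` is the tree THEOREM
`FACT_mem_BQP_holds`). [cite: Shor1997SICOMP, §5] -/
theorem FACT_mem_BPP_of_ffThesis (h : FFThesis) : FACT ∈ BPP :=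
  h (show FACT ∈ BQP from FACT_mem_BQP_holds)

/-- **Negative lemma modulo the classical hardness of factoring**: `FACT ∉ BPP → ¬ FFThesis`.
[cite: Shor1997SICOMP, §5] -/
theorem ffThesis_false_of_FACT_not_mem_BPP (h : FACT ∉ BPP) : ¬ FFThesis :=
  fun hX => h (FACT_mem_BPP_of_ffThesis hX)

/-- **Negative EDGE from route Shor's thesis** (registered item `stmt-QuantumAdvantage-0231`,
`Shor.ShorThesis := FACT ∉ BPP`): `ShorThesis → ¬ FFThesis` — the audit records this as a negative
edge between two route items (if 0231 is ever proved, 0242 is refuted). [cite: Shor1997SICOMP, §5] -/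
theorem ffThesis_false_of_shorThesis (h : ShorThesis) : ¬ FFThesis :=
  ffThesis_false_of_FACT_not_mem_BPP h

/-- Mirror edge: `FFThesis → ¬ ShorThesis` (X kills route Shor). [cite: Shor1997SICOMP, §5] -/
theorem shorThesis_false_of_ffThesis (hX : FFThesis) : ¬ ShorThesis :=
  fun h => h (FACT_mem_BPP_of_ffThesis hX)

/-- A kill separates `BPP` from `PSPACE` (tree theorem `BQP ⊆ PSPACE`). [cite: BernsteinVazirani1997, §8] -/
theorem not_PSPACE_subset_BPP_of_not_ffThesis (h : ¬ FFThesis) : ¬ (PSPACE ⊆ BPP) :=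
  fun hPB => h fun _ hL => hPB (BQP_subset_PSPACE_holds hL)

/-- A kill separates `BPP` from `PP` (tree theorem `BQP ⊆ PP`, Adleman–DeMarrais–Huang). [cite: AdlemanDeMarraisHuang1997, (BQP ⊆ PP)] -/
theorem not_PP_subset_BPP_of_not_ffThesis (h : ¬ FFThesis) : ¬ (PP ⊆ BPP) :=
  fun hPB => h fun _ hL => hPB (BQP_subset_PP_holds hL)

/-- A kill proves `P ≠ PSPACE` (with the tree theorem `P ⊆ BPP`). [folklore] -/
theorem P_ne_PSPACE_of_not_ffThesis (h : ¬ FFThesis) : Classes.P ≠ PSPACE :=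
  fun e => not_PSPACE_subset_BPP_of_not_ffThesis h fun _ hL => P_subset_BPP_holds (e.symm.subset hL)

/-- The relativized thesis is FALSE: not every oracle has `BQP^A ⊆ BPP^A` (recursive Fourier
sampling / Simon; tree theorem). [cite: BernsteinVazirani1997, Thm. 8.10 and Cor. 8.14] -/
theorem not_forall_oracle_thesis :
    ¬ ∀ A : Language Bool, BQPRel A ⊆ BPPRel (Oracle.ofLanguage A) := fun h => by
  obtain ⟨B, hB⟩ := exists_oracle_BQPRel_not_subset_BPPRel_holds
  exact hB (h B)

/-- The relativized KILL is false too: not every oracle has `BQP^A ⊄ BPP^A` (PSPACE-complete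
oracle; tree theorem). [cite: BernsteinVazirani1997, §8 (BQP ⊆ P^{#P} ⊆ PSPACE, relativizing)] -/
theorem not_forall_oracle_kill :
    ¬ ∀ A : Language Bool, ¬ BQPRel A ⊆ BPPRel (Oracle.ofLanguage A) := fun h => by
  obtain ⟨A, hA⟩ := exists_oracle_BQPRel_subset_BPPRel_holds
  exact h A hA

/-- BARRIERS (Literature theorems, used by name — a re-export was bounced as a duplicate, p82612):
neither the thesis shape `O ↦ BQP^O ⊆ BPP^O` nor the kill shape relativizes
(`Relativization.not_relativizes_either'`), and the kill shape does not algebrize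
(`Algebrization.not_isAlgebrizingSeparation_bit'`). Packaged here as ONE conjunction over the
tree's vocabulary so that the work file records the exact shapes. [cite: AroraBarakCC2009, Thm. 3.7] -/
theorem kill_must_evade_relativization_and_algebrization :
    ((¬ Relativizes fun O => bqpRelOf O ⊆ BPPRel O) ∧ ¬ Relativizes fun O => ¬ bqpRelOf O ⊆ BPPRel O) ∧
      ¬ IsAlgebrizingSeparation (fun O => BQPRel (Oracle.bitLanguage O)) BPPRel :=
  ⟨Relativization.not_relativizes_either', Algebrization.not_isAlgebrizingSeparation_bit'⟩

/-- Oracle-freeness is NOT load-bearing: `FFThesis ↔ BQP^∅ ⊆ BPP` (tree theorem `BQPRel 0 = BQP`). [cite: BernsteinVazirani1997, §8] -/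
theorem ffThesis_iff_BQPRel_zero : FFThesis ↔ BQPRel 0 ⊆ BPP := by
  have e : BQPRel 0 = BQP := BQPRel_zero_holds
  rw [ffThesis_iff, e]


/-! ### §4 Load-bearing parameters of the definition of `BQP` -/

/-! #### Uniformity is load-bearing -/

/-- `BQP` with poly-time UNIFORMITY dropped (polynomial SIZE kept): languages decided with error
`1/3` by some oracle-free, polynomial-size family of Clifford+T circuits (no condition tying the
circuits of different input lengths together; "BQP/poly-style" non-uniform families).
[cite: AroraBarakCC2009, §6.1] -/
def BQPNonuniform : Set (Language Bool) :=
  {L | ∃ F : QCircuitFamily cliffordT, F.IsOracleFree ∧ F.IsPolySize ∧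
    ∀ x, (x ∈ L → 2 / 3 ≤ F.acceptProbOn 0 x) ∧ (x ∉ L → F.acceptProbOn 0 x ≤ 1 / 3)}

/-- The crux with uniformity dropped: `BQPNonuniform ⊆ BPP`. [folklore] -/
def FFThesisWithoutUniformity : Prop :=
  BQPNonuniform ⊆ BPP

/-- `BQP ⊆ BQPNonuniform` (uniform families are polynomial-size, tree theorem
`IsUniform.isPolySize'`), so `FFThesisWithoutUniformity → FFThesis`: it is a strengthening. [cite: Yao1993] -/
theorem BQP_subset_BQPNonuniform : BQP ⊆ BQPNonuniform := by
  intro L hL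
  obtain ⟨F, hF, hU, h⟩ := ClassBQP.mem_BQP_iff.1 hL
  exact ⟨F, hF, hU.isPolySize', h⟩

/-- Hence the uniformity-free thesis implies the thesis. [folklore] -/
theorem ffThesis_of_withoutUniformity (h : FFThesisWithoutUniformity) : FFThesis :=
  fun _ hL => h (BQP_subset_BQPNonuniform hL)

/-- Reversible program on `n + 1` wires (inputs `0 … n-1`, one fresh ancilla `n`) that CLEARS
wire `0`: for `n = 0` nothing to do (wire `0` is the ancilla); for `n = k + 1`, `CNOT 0 → n`
copies `x₀` into the ancilla and `CNOT n → 0` cancels it. [folklore] -/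
def clearProg : (n : ℕ) → List (RevOp (n + 1))
  | 0 => []
  | k + 1 =>
    [RevOp.cnot ⟨0, by omega⟩ ⟨k + 1, by omega⟩ (Fin.ne_of_lt (Fin.mk_lt_mk.2 (Nat.succ_pos k))),
     RevOp.cnot ⟨k + 1, by omega⟩ ⟨0, by omega⟩ (Fin.ne_of_lt (Fin.mk_lt_mk.2 (Nat.succ_pos k))).symm]

/-- The flag program: `NOT` on wire `0` if the flag is set, nothing otherwise. [folklore] -/
def flagProg (b : Bool) (n : ℕ) : List (RevOp (n + 1)) :=
  if b then [RevOp.not ⟨0, Nat.succ_pos n⟩] else []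

/-- The NON-UNIFORM witness family of a bit sequence `χ : ℕ → Bool`: on inputs of length `n`,
clear wire `0` and write `χ n` on it (one ancilla, at most `3` reversible operations). [folklore] -/
def lengthFamily (χ : ℕ → Bool) : QCircuitFamily cliffordT where
  ancillas _ := 1
  circ n := ⟨revCompile (clearProg n ++ flagProg (χ n) n)⟩

/-- The ancilla wire `n` of a padded input `x 0` is `0`. [folklore] -/
theorem padInput_one_last {n : ℕ} (x : QReg n) : padInput x 1 ⟨n, Nat.lt_succ_self n⟩ = false := by
  have : (⟨n, Nat.lt_succ_self n⟩ : Fin (n + 1)) = Fin.natAdd n (0 : Fin 1) := by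
    ext; simp
  rw [this, padInput, Fin.append_right]

/-- `clearProg` clears wire `0` of a padded input. [folklore] -/
theorem revEval_clearProg_zero (n : ℕ) (x : QReg n) :
    revEval (clearProg n) (padInput x 1) ⟨0, Nat.succ_pos n⟩ = false := by
  cases n with
  | zero => simpa [clearProg, revEval] using padInput_one_last x
  | succ k =>
    have hlast : padInput x 1 ⟨k + 1, by omega⟩ = false := padInput_one_last x
    simp [clearProg, revEval, RevOp.eval, Function.update_self, hlast]

/-- The witness program leaves `χ n` on wire `0`. [folklore] -/
theorem revEval_witness_zero (b : Bool) (n : ℕ) (x : QReg n) :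
    revEval (clearProg n ++ flagProg b n) (padInput x 1) ⟨0, Nat.succ_pos n⟩ = b := by
  rw [revEval_append]
  cases b with
  | false => simpa [flagProg, revEval] using revEval_clearProg_zero n x
  | true =>
    show revEval [RevOp.not ⟨0, Nat.succ_pos n⟩] (revEval (clearProg n) (padInput x 1))
      ⟨0, Nat.succ_pos n⟩ = true
    simp only [revEval, RevOp.eval, Function.update_self, revEval_clearProg_zero n x, Bool.not_false]

/-- The witness family is oracle-free. [folklore] -/
theorem lengthFamily_isOracleFree (χ : ℕ → Bool) : (lengthFamily χ).IsOracleFree :=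
  fun _ => revCompile_isOracleFree _

/-- The witness family has constant (hence polynomial) size: `≤ 72` gates, `1` ancilla. [folklore] -/
theorem lengthFamily_isPolySize (χ : ℕ → Bool) : (lengthFamily χ).IsPolySize := by
  refine ⟨Polynomial.C 72, fun n => ⟨?_, by simp [lengthFamily]⟩⟩
  have hops : (clearProg n ++ flagProg (χ n) n).length ≤ 3 := by
    rw [List.length_append]
    have h1 : (clearProg n).length ≤ 2 := by cases n <;> simp [clearProg]
    have h2 : (flagProg (χ n) n).length ≤ 1 := by unfold flagProg; split <;> simp
    omega
  show (revCompile (clearProg n ++ flagProg (χ n) n)).length ≤ (Polynomial.C 72).eval n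
  rw [Polynomial.eval_C]
  exact (length_revCompile_le _).trans (by omega)

/-- **Acceptance probability of the witness family**: exactly `[χ |x|]`. [folklore] -/
theorem lengthFamily_acceptProbOn (χ : ℕ → Bool) (x : List Bool) :
    (lengthFamily χ).acceptProbOn 0 x = if χ x.length then 1 else 0 := by
  show QCircuit.acceptProb 0 (⟨revCompile (clearProg x.length ++ flagProg (χ x.length) x.length)⟩ :
    QCircuit cliffordT (x.length + 1)) x.get = _
  rw [QCircuit.acceptProb_of_runOn_eq_basisState 0 _ x.get
    (revEval (clearProg x.length ++ flagProg (χ x.length) x.length) (padInput x.get 1))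
    (Nat.succ_pos _) (revCompile_mulVec_basisState 0 _ _), revEval_witness_zero]

/-- **Every length-language is decided (exactly) by a polynomial-size non-uniform family**:
`lengthSet S ∈ BQPNonuniform` for EVERY `S ⊆ ℕ`. [folklore] -/
theorem lengthSet_mem_BQPNonuniform (S : Set ℕ) :
    Literature.Computability.MetaComplexity.lengthSet S ∈ BQPNonuniform := by
  refine ⟨lengthFamily S.boolIndicator, lengthFamily_isOracleFree _, lengthFamily_isPolySize _,
    fun x => ⟨fun hx => ?_, fun hx => ?_⟩⟩
  · have hb : S.boolIndicator x.length = true := (Set.mem_iff_boolIndicator S x.length).1 hx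
    rw [lengthFamily_acceptProbOn, hb]; norm_num
  · have hb : S.boolIndicator x.length = false := (Set.notMem_iff_boolIndicator S x.length).1 hx
    rw [lengthFamily_acceptProbOn, hb]; norm_num

/-- `BQPNonuniform` is UNCOUNTABLE (it contains the `2^ℵ₀` length-languages; Cantor). [folklore] -/
theorem not_countable_BQPNonuniform : ¬ BQPNonuniform.Countable := by
  intro hc
  have huniv : (Set.univ : Set (Set ℕ)).Countable :=
    Set.MapsTo.countable_of_injOn (f := Literature.Computability.MetaComplexity.lengthSet)
      (fun S _ => lengthSet_mem_BQPNonuniform S)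
      Literature.Computability.MetaComplexity.lengthSet_injective.injOn hc
  haveI : Countable (Set ℕ) := Set.countable_univ_iff.1 huniv
  obtain ⟨f, hf⟩ := exists_surjective_nat (Set ℕ)
  exact Function.cantor_surjective f hf

/-- **Uniformity is load-bearing**: `¬ (BQPNonuniform ⊆ BPP)` — `BPP` is countable (tree theorem
`countable_BPP`), `BQPNonuniform` is not. Any proof of the crux must USE `IsUniform`. [folklore] -/
theorem ffThesis_false_without_uniformity : ¬ FFThesisWithoutUniformity :=
  fun h => not_countable_BQPNonuniform (Literature.Computability.MetaComplexity.countable_BPP.mono h)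


/-! #### Sharpening: the non-uniform witness is `T`-free and basis-preserving -/

/-- The witness programs use only `NOT` and `CNOT`: their compilations are `T`-FREE (pure
Clifford words `H S S H`, `CNOT`). [folklore] -/
theorem tCount_lengthFamily (χ : ℕ → Bool) (n : ℕ) : ((lengthFamily χ).circ n).tCount = 0 := by
  show (⟨revCompile (clearProg n ++ flagProg (χ n) n)⟩ : QCircuit cliffordT (n + 1)).tCount = 0
  rw [QCircuit.tCount_eq_zero_iff]
  intro q hq e hqe
  subst hqe
  simp only [revCompile, List.mem_flatMap, List.mem_append] at hq
  obtain ⟨op, hop, hq⟩ := hq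
  have hshape : (∃ i, op = RevOp.not i) ∨ ∃ i j h, op = RevOp.cnot i j h := by
    rcases hop with hop | hop
    · cases n with
      | zero => simp [clearProg] at hop
      | succ k =>
        simp only [clearProg, List.mem_cons, List.not_mem_nil, or_false] at hop
        rcases hop with rfl | rfl
        · exact Or.inr ⟨_, _, _, rfl⟩
        · exact Or.inr ⟨_, _, _, rfl⟩
    · unfold flagProg at hop
      split at hop
      · simp only [List.mem_singleton] at hop
        exact Or.inl ⟨_, hop⟩
      · simp at hop
  rcases hshape with ⟨i, rfl⟩ | ⟨i, j, h, rfl⟩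
  · simp [RevOp.compile, xWord, hOn, sOn] at hq
  · simp [RevOp.compile, cnotOn] at hq

/-- The witness circuits map every basis state to a basis state (classical reversible dynamics):
all states along the family are computational-basis product states — bond dimension `1` at every
cut, stabilizer rank `1`, one nonzero Pauli-`Z`-diagonal expectation pattern. [folklore] -/
theorem lengthFamily_basis_to_basis (χ : ℕ → Bool) (n : ℕ) (w : QReg (n + 1)) :
    ∃ w' : QReg (n + 1), Matrix.mulVec (((lengthFamily χ).circ n).toMatrix 0) (basisState w) =
      basisState w' :=
  ⟨_, revCompile_mulVec_basisState 0 _ w⟩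

/-- Some length-language lies OUTSIDE `BPP` (`2^ℵ₀` of them against the countable `BPP`; Cantor,
non-constructive). [cite: AroraBarakCC2009, §1.4] -/
theorem exists_lengthSet_not_mem_BPP : ∃ S : Set ℕ, Literature.Computability.MetaComplexity.lengthSet S ∉ BPP := by
  by_contra h
  push Not at h
  have huniv : (Set.univ : Set (Set ℕ)).Countable :=
    Set.MapsTo.countable_of_injOn (f := Literature.Computability.MetaComplexity.lengthSet) (fun S _ => h S) Literature.Computability.MetaComplexity.lengthSet_injective.injOn
      Literature.Computability.MetaComplexity.countable_BPP
  haveI : Countable (Set ℕ) := Set.countable_univ_iff.1 huniv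
  obtain ⟨f, hf⟩ := exists_surjective_nat (Set ℕ)
  exact Function.cantor_surjective f hf

/-- **STATE-COMPLEXITY ROADS NEED UNIFORMITY.** There is a language OUTSIDE `BPP` decided EXACTLY
(acceptance probability `1` on it, `0` off it) by an oracle-free, polynomial-size, `T`-FREE
(`tCount = 0`, pure Clifford) family all of whose circuits map basis states to basis states. So no
hypothesis bounding the entanglement / magic / stabilizer rank / Pauli spectrum of the STATES of a
family — the currencies of the roads H_FF (SymplecticPurity), H_PP (PauliFlat), H_CL
(ShorLocallyDark), stabilizer-rank dequantization (Dequantize) — can by itself put the decided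
language in `BPP`: every such road to X must also thread the UNIFORM GENERATOR of the family through
the classical simulation. [folklore] -/
theorem exists_tfree_basis_family_deciding_non_BPP :
    ∃ S : Set ℕ, Literature.Computability.MetaComplexity.lengthSet S ∉ BPP ∧ ∃ F : QCircuitFamily cliffordT,
      F.IsOracleFree ∧ F.IsPolySize ∧ (∀ n, (F.circ n).tCount = 0) ∧
      (∀ (n : ℕ) (w : QReg (n + F.ancillas n)), ∃ w' : QReg (n + F.ancillas n),
        Matrix.mulVec ((F.circ n).toMatrix 0) (basisState w) = basisState w') ∧
      ∀ x, (x ∈ Literature.Computability.MetaComplexity.lengthSet S → F.acceptProbOn 0 x = 1) ∧ (x ∉ Literature.Computability.MetaComplexity.lengthSet S → F.acceptProbOn 0 x = 0) := by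
  obtain ⟨S, hS⟩ := exists_lengthSet_not_mem_BPP
  refine ⟨S, hS, lengthFamily S.boolIndicator, lengthFamily_isOracleFree _, lengthFamily_isPolySize _,
    tCount_lengthFamily _, lengthFamily_basis_to_basis _, fun x => ⟨fun hx => ?_, fun hx => ?_⟩⟩
  · have hb : S.boolIndicator x.length = true := (Set.mem_iff_boolIndicator S x.length).1 hx
    rw [lengthFamily_acceptProbOn, hb]; rfl
  · have hb : S.boolIndicator x.length = false := (Set.notMem_iff_boolIndicator S x.length).1 hx
    rw [lengthFamily_acceptProbOn, hb]; rfl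


/-! #### The `1/3`–`2/3` gap is load-bearing -/

/-- The crux with the error bound relaxed from `1/3` to the cut-point `1/2`
(`x ∈ L → Pr[accept] ≥ 1/2`, `x ∉ L → Pr[accept] ≤ 1/2`, still UNIFORM families). [folklore] -/
def FFThesisWithoutGap : Prop :=
  BQPWith cliffordT (1 / 2) ⊆ BPP

/-- `BQP ⊆ BQPWith cliffordT (1/2)`, so `FFThesisWithoutGap → FFThesis`: a strengthening. [folklore] -/
theorem ffThesis_of_withoutGap (h : FFThesisWithoutGap) : FFThesis :=
  fun _ hL => h (BQPWith_mono (by norm_num) hL)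

/-- The Hadamard sign factor has modulus `1`. [folklore] -/
theorem norm_hSign {N : ℕ} (ws : List (Fin N)) (w z : QReg N) : ‖Kitaev1995.hSign ws w z‖ = 1 := by
  induction ws with
  | nil => simp
  | cons i ws ih =>
    rw [Kitaev1995.hSign_cons, norm_mul, ih, mul_one]
    split <;> simp

/-- Half of the bit strings have a given bit set: `∑_y [y_i = 1]·c = 2^N c / 2`. [folklore] -/
theorem sum_ite_apply_eq (N : ℕ) (i : Fin N) (c : ℝ) :
    (∑ y : QReg N, if y i = true then c else 0) = 2 ^ N * c / 2 := by
  have hinv : Function.Involutive (fun y : QReg N => Function.update y i (!y i)) := by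
    intro y
    funext j
    by_cases hj : j = i
    · subst hj; simp
    · simp [Function.update_of_ne hj]
  set e : Equiv.Perm (QReg N) := hinv.toPerm _ with he
  have hey : ∀ y : QReg N, e y i = !y i := fun y => by
    simp [he]
  have h1 : (∑ y : QReg N, if y i = true then c else 0) =
      ∑ y : QReg N, if e y i = true then c else 0 :=
    (Equiv.sum_comp e (fun y : QReg N => if y i = true then c else 0)).symm
  have h2 : ∀ y : QReg N,
      ((if y i = true then c else 0) + if e y i = true then c else 0) = c := fun y => by
    rw [hey]; cases y i <;> simp
  have h3 : 2 * (∑ y : QReg N, if y i = true then c else 0) = ∑ _y : QReg N, c := by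
    rw [two_mul]
    conv_lhs => arg 2; rw [h1]
    rw [← Finset.sum_add_distrib]
    exact Finset.sum_congr rfl fun y _ => h2 y
  have h4 : 2 * (∑ y : QReg N, if y i = true then c else 0) = 2 ^ N * c := by
    rw [h3, Finset.sum_const, Finset.card_univ, nsmul_eq_mul]
    simp
  linear_combination (1 / 2 : ℝ) * h4

/-- **The coin family accepts every non-empty input with probability exactly `1/2`**
(`H^{⊗n}|x⟩` has all amplitudes `±2^{-n/2}`). [cite: NielsenChuang2010, §1.4.4] -/
theorem hadFamily_acceptProbOn {x : List Bool} (hx : x ≠ []) :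
    PostBPPSim.hadFamily.acceptProbOn 0 x = 1 / 2 := by
  have hn : 0 < x.length := List.length_pos_iff.2 hx
  have hamp : ∀ y : QReg (x.length + 0),
      ‖QCircuit.runOn 0 (⟨(List.finRange x.length).map hOn⟩ : QCircuit cliffordT (x.length + 0))
        (basisState (padInput x.get 0)) y‖ ^ 2 = (1 / 2 : ℝ) ^ x.length := by
    intro y
    have h := Kitaev1995.hadamards_mulVec_basisState_signed (List.finRange x.length)
      (List.nodup_finRange _) (padInput x.get 0)
    have hy := congrFun h y
    rw [List.length_finRange, if_pos (fun j hj => absurd (List.mem_finRange j) hj)] at hy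
    show ‖Matrix.mulVec ((⟨(List.finRange x.length).map hOn⟩ : QCircuit cliffordT (x.length + 0)).toMatrix 0)
      (basisState (padInput x.get 0)) y‖ ^ 2 = _
    rw [hy, norm_mul, mul_pow, norm_invSqrt2_pow_sq, norm_hSign, one_pow, mul_one]
  have hpos : 0 < x.length + 0 := hn
  have hone : (2 : ℝ) ^ (x.length + 0) * (1 / 2) ^ x.length = 1 := by
    rw [Nat.add_zero, ← mul_pow]; norm_num
  show QCircuit.acceptProb 0 (⟨(List.finRange x.length).map hOn⟩ : QCircuit cliffordT (x.length + 0))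
    x.get = 1 / 2
  unfold QCircuit.acceptProb
  rw [Finset.sum_congr rfl (fun y _ => by rw [dif_pos hpos])]
  simp only [hamp]
  rw [sum_ite_apply_eq, hone]

/-- On the empty input the coin family has no wire `0`: acceptance probability `0` (junk value of
`acceptProb` on the empty register). [folklore] -/
theorem hadFamily_acceptProbOn_nil : PostBPPSim.hadFamily.acceptProbOn 0 [] = 0 := by
  unfold QCircuitFamily.acceptProbOn QCircuit.acceptProb
  simp

/-- **At cut-point `1/2` every language avoiding the empty word is "decided"** by the (uniform!)
coin family. [folklore] -/
theorem mem_BQPWith_half {L : Language Bool} (hL : [] ∉ L) : L ∈ BQPWith cliffordT (1 / 2) := by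
  refine ⟨PostBPPSim.hadFamily, PostBPPSim.hadFamily_isOracleFree, PostBPPSim.hadFamily_isUniform,
    fun x => ?_⟩
  by_cases hx : x = []
  · subst hx
    refine ⟨fun h => absurd h hL, fun _ => ?_⟩
    rw [hadFamily_acceptProbOn_nil]; norm_num
  · rw [hadFamily_acceptProbOn hx]
    constructor <;> intro _ <;> norm_num

/-- The shifted length-languages `lengthSet (succ '' S)` avoid the empty word and are in the
cut-point class, for every `S ⊆ ℕ`. [folklore] -/
theorem lengthSet_succ_mem_BQPWith_half (S : Set ℕ) :
    Literature.Computability.MetaComplexity.lengthSet (Nat.succ '' S) ∈ BQPWith cliffordT (1 / 2) := by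
  refine mem_BQPWith_half fun h => ?_
  rw [Literature.Computability.MetaComplexity.mem_lengthSet_iff] at h
  obtain ⟨n, -, hn⟩ := h
  exact Nat.succ_ne_zero n hn

/-- The cut-point class is UNCOUNTABLE. [folklore] -/
theorem not_countable_BQPWith_half : ¬ (BQPWith cliffordT (1 / 2)).Countable := by
  intro hc
  have hinj : Function.Injective fun S : Set ℕ =>
      Literature.Computability.MetaComplexity.lengthSet (Nat.succ '' S) :=
    Literature.Computability.MetaComplexity.lengthSet_injective.comp
      (Set.image_injective.2 Nat.succ_injective)
  have huniv : (Set.univ : Set (Set ℕ)).Countable :=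
    Set.MapsTo.countable_of_injOn
      (f := fun S : Set ℕ => Literature.Computability.MetaComplexity.lengthSet (Nat.succ '' S))
      (fun S _ => lengthSet_succ_mem_BQPWith_half S) hinj.injOn hc
  haveI : Countable (Set ℕ) := Set.countable_univ_iff.1 huniv
  obtain ⟨f, hf⟩ := exists_surjective_nat (Set ℕ)
  exact Function.cantor_surjective f hf

/-- **The error bound `ε < 1/2` is load-bearing**: `¬ (BQPWith cliffordT (1/2) ⊆ BPP)`. Any proof
of the crux must USE `1/3 < 1/2`, not just uniformity and polynomial size. (The witness exploits
exact ties `Pr = 1/2` against the non-strict clauses — a degeneracy of the cut-point definition; the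
strict unbounded-error variant is `PP`-like and open.) [folklore] -/
theorem ffThesis_false_without_gap : ¬ FFThesisWithoutGap :=
  fun h => not_countable_BQPWith_half (Literature.Computability.MetaComplexity.countable_BPP.mono h)

/-- The same for every error bound `ε ≥ 1/2` (monotonicity of `BQPWith`). [folklore] -/
theorem not_BQPWith_subset_BPP {ε : ℝ} (hε : 1 / 2 ≤ ε) : ¬ (BQPWith cliffordT ε ⊆ BPP) :=
  fun h => ffThesis_false_without_gap fun _ hL => h (BQPWith_mono hε hL)

/-- Below the cut-point the error bound is immaterial: `BQPWith cliffordT ε = BQP` for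
`0 < ε < 1/2` (error reduction, tree THEOREM `BQPWith_eq_BQP_holds`); together with
`not_BQPWith_subset_BPP` the dependence of "`BQPWith ε ⊆ BPP`" on `ε` is a sharp dichotomy at
`1/2` (open for `ε < 1/2`, false for `ε ≥ 1/2`). [cite: BernsteinVazirani1997, §8] -/
theorem BQPWith_subset_BPP_iff_of_lt_half {ε : ℝ} (h0 : 0 < ε) (h : ε < 1 / 2) :
    BQPWith cliffordT ε ⊆ BPP ↔ FFThesis := by
  have e : BQPWith cliffordT ε = BQP := BQPWith_eq_BQP_holds h0 h
  rw [e]; rfl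

/-! ### §5 Neighbouring theses -/

/-- The PROMISE-class thesis implies the crux: `PromiseBQP ⊆ PromiseBPP' → FFThesis` (trivial
promises; tree theorems `ofLanguage_mem_PromiseBQP_iff`, `ofLanguage_mem_PromiseBPP'_iff`). So the
promise version (routes PromiseLift / GenericInertness vocabulary) is a strengthening of X, and a
kill of X kills it too. [cite: Goldreich2006, §1.2 (Def. 2)] -/
theorem ffThesis_of_promiseBQP_subset (h : PromiseBQP ⊆ PromiseBPP') : FFThesis := by
  intro L hL
  have h1 : PromiseProblem.ofLanguage L ∈ PromiseBQP := ofLanguage_mem_PromiseBQP_iff.2 hL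
  exact ofLanguage_mem_PromiseBPP'_iff.1 (h h1)

/-- Contrapositive: a kill of the crux refutes the promise-class thesis. [cite: Goldreich2006, §1.2 (Def. 2)] -/
theorem not_promiseBQP_subset_of_not_ffThesis (h : ¬ FFThesis) : ¬ (PromiseBQP ⊆ PromiseBPP') :=
  fun hP => h (ffThesis_of_promiseBQP_subset hP)

/-! ### §6 Why it resists (summary) -/

/-- **WHY THE CRUX RESISTS DISPROOF** (summary for ideators / planners / the lead).
1. A disproof of X = `BQP ⊆ BPP` is, term for term, a proof of the summit `QuantumAdvantage`
   (`not_ffThesis_iff_quantumAdvantage`); it implies `PP ⊄ BPP`, `PSPACE ⊄ BPP`, `P ≠ PSPACE`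
   (§3) — no unconditional technique in print reaches any of these.
2. It must be NON-RELATIVIZING and NON-ALGEBRIZING: both the thesis shape and the kill shape fail
   relative to suitable oracles (`kill_must_evade_relativization_and_algebrization`; tree theorems
   `Relativization_holds`, `Algebrization_holds`).
3. The definitions offer no artefact: BQP/BPP are the genuine classes (audit in NOTES.md), the
   sandwich `P ⊆ BPP ⊆ BQP ⊆ PP ⊆ PSPACE` and `FACT ∈ BQP` are proved in the tree, so neither a
   junk refutation nor a junk proof exists; the only junk value (`acceptProb = 0` on the EMPTY
   register) is a finite variation.
4. What IS refutable are the strengthenings that drop a parameter of `BQP`: uniformity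
   (`ffThesis_false_without_uniformity`, substantive: `2^ℵ₀` length-languages) and the error bound
   `ε < 1/2` (`ffThesis_false_without_gap`, sharp at `ε = 1/2` but exploiting exact ties — a
   degeneracy of the non-strict cut-point clauses, not computational power); oracle-freeness is
   immaterial (`ffThesis_iff_BQPRel_zero`). So every dequantization road to X must exploit the
   UNIFORM GENERATOR of the family (a simulator correct input-length by input-length for arbitrary
   poly-size Clifford+T families cannot exist) and the bounded-error regime `ε < 1/2`.
5. Conditional kills available in the tree: `FACT ∉ BPP → ¬X` (§2, Shor); the oracle evidence
   `∃ A, BQP^A ⊄ BPP^A` (BV97/Simon; `exists_oracle_BQPRel_not_subset_BPPRel_holds`) and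
   `∃ A, BQP^A ⊄ PH^A` (Raz–Tal; `exists_oracle_BQPRel_not_subset_PHRel_holds`).
[folklore] -/
theorem resists : ¬ FFThesis ↔ ∃ L : Language Bool, L ∈ BQP ∧ L ∉ BPP :=
  not_ffThesis_iff_quantumAdvantage

end Summit.QuantumAdvantage.QuantumAdvantage.Cruxes.DeqThesis.Disproof

end
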